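import Mathlib
import Summits.Langlands.Langlands.Theorems.CapacityClassicalityHilbertIntegralOverconvergentIsCongruenceStubTraceEncodingInjective
import Summits.Langlands.Langlands.Theorems.CapacityClassicalityHilbertIntegralOverconvergentIsCongruenceStubTracePosOfTotallyPositive

/-!
# Crux `HilbertIntegralOverconvergentIsCongruence` (stmt-Langlands-8485), line `Sketch-ideate-r1-k1`:
# stub S13b — the exponent count `Λ(n) ≤ c_Λ n^d`

Hilbert modular `q`-expansions over a totally real field `F` of degree `d` are indexed by totally
positive algebraic integers `ν`, weighted by `Tr_{F/ℚ}(αν)` for a fixed totally positive `α`.  The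
line's Siegel-lemma count needs a polynomial bound on the number of exponents of weight `< n`:

* `stub_latticeCountTrace` (registered stub S13b) — given a `ℚ`-basis `β` of `F` consisting of
  totally positive algebraic integers, there is `c_Λ > 0` with
  `#{ν ∈ 𝓞_F totally positive | Tr(αν) < n} ≤ c_Λ n^d` for all `n ≥ 1`.

Proof: with `c := Σ_j Σ_σ σ(β_j)/σ(α)` (sum over the — real — complex embeddings `σ`), every
totally positive `ν` satisfies `0 < Tr(β_j ν) = Σ_σ σ(β_j) σ(ν) ≤ c Σ_σ σ(α) σ(ν) = c Tr(αν)`, and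
`Tr(β_j ν) ∈ ℤ` (`β_j ν` is an algebraic integer).  Hence `ν ↦ (⌊Tr(β_j ν)⌋)_j` — injective on
`𝓞_F` by `stub_traceEncodingInjective` — maps the set into the integer box `[0, ⌊c n⌋ + 1)^d`,
of cardinality `(⌊c n⌋ + 1)^d ≤ ((c + 1) n)^d`.

Theorems only, no `sorry`.
-/

set_option linter.dupNamespace false

open scoped NumberField

namespace Summit.Langlands.Langlands.Theorems.HilbertIntegralOverconvergentIsCongruence

open NumberField

/-- The real-valued trace `Tr_{F/ℚ}(x)` of an element of a number field is the sum, over the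
`ℚ`-algebra embeddings `σ : F →ₐ[ℚ] ℂ`, of the real parts `(σ x).re`. -/
private theorem latCount_trace_real_eq_sum_re (F : Type*) [Field F] [NumberField F] (x : F) :
    ((Algebra.trace ℚ F x : ℚ) : ℝ) = ∑ σ : F →ₐ[ℚ] ℂ, (σ x).re := by
  have h := trace_eq_sum_embeddings ℂ (K := ℚ) (L := F) (x := x)
  rw [eq_ratCast] at h
  rw [← Complex.ratCast_re, h, Complex.re_sum]

/-- The trace `Tr_{F/ℚ}(β ν)` of a product of two algebraic integers of a number field is a
rational integer. -/
private theorem latCount_exists_int_eq_trace (F : Type*) [Field F] [NumberField F] (β ν : 𝓞 F) :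
    ∃ m : ℤ, (m : ℚ) = Algebra.trace ℚ F ((β : F) * (ν : F)) := by
  have hx : IsIntegral ℤ ((β : F) * (ν : F)) :=
    (RingOfIntegers.isIntegral_coe β).mul (RingOfIntegers.isIntegral_coe ν)
  obtain ⟨m, hm⟩ := IsIntegrallyClosed.isIntegral_iff.mp (Algebra.isIntegral_trace (L := ℚ) hx)
  exact ⟨m, (eq_intCast (algebraMap ℤ ℚ) m).symm.trans hm⟩

/-- **stub S13b — `stub_latticeCountTrace` (M; the exponent count `Λ(n) ≤ c_Λ n^d`).**  `F` totally real of
degree `d`, `α ∈ F` totally positive, `β` a `ℚ`-basis of `F` made of totally positive algebraic integers.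
Then for some `c_Λ > 0` and all `n ≥ 1` the number of totally positive algebraic integers `ν` with
`Tr(αν) < n` is at most `c_Λ n^d` (inject by `ν ↦ (Tr(β_j ν))_j` — injective by the non-degeneracy of the trace
form, `stub_traceEncodingInjective` — into the integer box `[0, c n)^d`, `c = max_j max_τ τβ_j/τα`, since
`0 < Tr(β_j ν) = Σ_τ τβ_j τν ≤ c Σ_τ τα τν = c Tr(αν)`). [folklore] -/
theorem stub_latticeCountTrace (F : Type*) [Field F] [NumberField F] [NumberField.IsTotallyReal F]
    (α : F) (hα : ∀ τ : F →+* ℝ, 0 < τ α)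
    (β : Fin (Module.finrank ℚ F) → 𝓞 F) (hβ : LinearIndependent ℚ (fun j ↦ (β j : F)))
    (hβpos : ∀ j (τ : F →+* ℝ), 0 < τ (β j)) :
    ∃ cΛ : ℝ, 0 < cΛ ∧ ∀ n : ℕ, 1 ≤ n →
      ({ν : 𝓞 F | (∀ τ : F →+* ℝ, 0 < τ (ν : F)) ∧ ((Algebra.trace ℚ F (α * ν) : ℚ) : ℝ) < n}.ncard : ℝ) ≤
        cΛ * (n : ℝ) ^ Module.finrank ℚ F := by
  classical
  -- every complex embedding of the totally real field `F` is real
  have hreal : ∀ σ : F →ₐ[ℚ] ℂ, ComplexEmbedding.IsReal (σ : F →+* ℂ) := fun σ =>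
    IsTotallyReal.complexEmbedding_isReal _
  -- the comparison constant `c` with `σ(β_j) ≤ c σ(α)` for all `j` and all embeddings `σ`
  set c : ℝ := ∑ j, ∑ σ : F →ₐ[ℚ] ℂ, (hreal σ).embedding (β j : F) / (hreal σ).embedding α
    with hc_def
  have hc0 : 0 ≤ c := Finset.sum_nonneg fun j _ => Finset.sum_nonneg fun σ _ =>
    (div_pos (hβpos j _) (hα _)).le
  have hratio : ∀ j (σ : F →ₐ[ℚ] ℂ),
      (hreal σ).embedding (β j : F) ≤ c * (hreal σ).embedding α := by
    intro j σ
    rw [← div_le_iff₀ (hα _)]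
    calc (hreal σ).embedding (β j : F) / (hreal σ).embedding α
        ≤ ∑ σ' : F →ₐ[ℚ] ℂ, (hreal σ').embedding (β j : F) / (hreal σ').embedding α :=
          Finset.single_le_sum
            (f := fun σ' : F →ₐ[ℚ] ℂ => (hreal σ').embedding (β j : F) / (hreal σ').embedding α)
            (fun σ' _ => (div_pos (hβpos j _) (hα _)).le) (Finset.mem_univ σ)
      _ ≤ c :=
          Finset.single_le_sum
            (f := fun j' => ∑ σ' : F →ₐ[ℚ] ℂ,
              (hreal σ').embedding (β j' : F) / (hreal σ').embedding α)
            (fun j' _ => Finset.sum_nonneg fun σ' _ => (div_pos (hβpos j' _) (hα _)).le)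
            (Finset.mem_univ j)
  -- trace comparison `Tr(β_j ν) ≤ c Tr(α ν)` for totally positive `ν`
  have htrle : ∀ j (ν : F), (∀ τ : F →+* ℝ, 0 < τ ν) →
      ((Algebra.trace ℚ F ((β j : F) * ν) : ℚ) : ℝ) ≤
        c * ((Algebra.trace ℚ F (α * ν) : ℚ) : ℝ) := by
    intro j ν hν
    rw [latCount_trace_real_eq_sum_re, latCount_trace_real_eq_sum_re, Finset.mul_sum]
    refine Finset.sum_le_sum fun σ _ => ?_
    have e1 : (σ ((β j : F) * ν)).re = (hreal σ).embedding (β j : F) * (hreal σ).embedding ν := by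
      rw [← map_mul]
      rfl
    have e2 : (σ (α * ν)).re = (hreal σ).embedding α * (hreal σ).embedding ν := by
      rw [← map_mul]
      rfl
    rw [e1, e2, ← mul_assoc]
    exact mul_le_mul_of_nonneg_right (hratio j σ) (hν _).le
  -- the integer encoding `ν ↦ (⌊Tr(β_j ν)⌋)_j`, injective on `𝓞 F`
  let E : 𝓞 F → (Fin (Module.finrank ℚ F) → ℤ) := fun ν j =>
    ⌊Algebra.trace ℚ F ((β j : F) * (ν : F))⌋
  have hkey := stub_traceEncodingInjective F (fun j => (β j : F)) hβ rfl
  have hEinj : Function.Injective E := by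
    intro ν ν' h
    have hj : ∀ j, Algebra.trace ℚ F ((β j : F) * (ν : F)) =
        Algebra.trace ℚ F ((β j : F) * (ν' : F)) := by
      intro j
      obtain ⟨m, hm⟩ := latCount_exists_int_eq_trace F (β j) ν
      obtain ⟨m', hm'⟩ := latCount_exists_int_eq_trace F (β j) ν'
      have h' : ⌊Algebra.trace ℚ F ((β j : F) * (ν : F))⌋ =
          ⌊Algebra.trace ℚ F ((β j : F) * (ν' : F))⌋ := congr_fun h j
      rw [← hm, ← hm', Int.floor_intCast, Int.floor_intCast] at h'
      rw [← hm, ← hm', h']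
    have hνν' : (ν : F) = (ν' : F) := hkey (funext hj)
    exact RingOfIntegers.ext hνν'
  -- the constant
  refine ⟨(c + 1) ^ Module.finrank ℚ F, pow_pos (by linarith) _, fun n hn => ?_⟩
  set S : Set (𝓞 F) :=
    {ν : 𝓞 F | (∀ τ : F →+* ℝ, 0 < τ (ν : F)) ∧ ((Algebra.trace ℚ F (α * ν) : ℚ) : ℝ) < n}
    with hS_def
  -- the side of the integer box
  set K : ℕ := ⌊c * n⌋₊ + 1 with hK_def
  -- the image of `S` under `E` lies in the box `[0, K)^d`
  have hmem : ∀ ν ∈ S, E ν ∈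
      ((Fintype.piFinset fun _ : Fin (Module.finrank ℚ F) => Finset.Ico (0 : ℤ) (K : ℤ)) :
        Set (Fin (Module.finrank ℚ F) → ℤ)) := by
    rintro ν ⟨hpos, htr⟩
    rw [Finset.mem_coe, Fintype.mem_piFinset]
    intro j
    rw [Finset.mem_Ico]
    have h0 : (0 : ℚ) < Algebra.trace ℚ F ((β j : F) * (ν : F)) :=
      stub_tracePosOfTotallyPositive F (β j : F) (ν : F) (hβpos j) hpos
    have h1 : ((Algebra.trace ℚ F ((β j : F) * (ν : F)) : ℚ) : ℝ) < K := by
      calc ((Algebra.trace ℚ F ((β j : F) * (ν : F)) : ℚ) : ℝ)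
          ≤ c * ((Algebra.trace ℚ F (α * ν) : ℚ) : ℝ) := htrle j ν hpos
        _ ≤ c * n := mul_le_mul_of_nonneg_left htr.le hc0
        _ < ⌊c * n⌋₊ + 1 := Nat.lt_floor_add_one _
        _ = (K : ℝ) := by rw [hK_def, Nat.cast_add_one]
    refine ⟨Int.floor_nonneg.mpr h0.le, Int.floor_lt.mpr ?_⟩
    exact_mod_cast h1
  -- cardinality comparison
  have hcard : S.ncard ≤ K ^ Module.finrank ℚ F := by
    have h := Set.ncard_le_ncard_of_injOn E hmem hEinj.injOn (Finset.finite_toSet _)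
    rwa [Set.ncard_coe_finset, Fintype.card_piFinset_const, Int.card_Ico, sub_zero,
      Int.toNat_natCast] at h
  -- real arithmetic
  have hK : (K : ℝ) ≤ (c + 1) * n := by
    rw [hK_def, Nat.cast_add_one]
    have h1 : (⌊c * (n : ℝ)⌋₊ : ℝ) ≤ c * n := Nat.floor_le (mul_nonneg hc0 (Nat.cast_nonneg n))
    have h2 : (1 : ℝ) ≤ n := by exact_mod_cast hn
    have h3 : (c + 1) * (n : ℝ) = c * n + n := by ring
    linarith
  calc (S.ncard : ℝ) ≤ ((K ^ Module.finrank ℚ F : ℕ) : ℝ) := by exact_mod_cast hcard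
    _ = (K : ℝ) ^ Module.finrank ℚ F := Nat.cast_pow K _
    _ ≤ ((c + 1) * n) ^ Module.finrank ℚ F := pow_le_pow_left₀ (Nat.cast_nonneg _) hK _
    _ = (c + 1) ^ Module.finrank ℚ F * (n : ℝ) ^ Module.finrank ℚ F := mul_pow _ _ _

end Summit.Langlands.Langlands.Theorems.HilbertIntegralOverconvergentIsCongruence
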